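import Summits.KontsevichZagierPeriods.KontsevichZagierPeriods.Theorems.CommonUnfoldingPeakNormalFormWeightedCoupling

/-!
# The `k × l` interchange (route CommonUnfolding, crux `PeakNormalForm`, stub `stub_klInterchange`)

Rung 1 of the diamond ladder of stmt-KontsevichZagierPeriods-4828 (`PeakNormalForm`), one step
above the floor `InterchangeLemma` (stmt-4830, the case `k = l = 0`): `k + 1` bands against `l + 1`
bands over ONE base domain, the two families of base integrands agreeing AFTER integrand additivity
(`∑ᵢ gᵢ = G = ∑ⱼ g'ⱼ`, a rule-1b seam), nondegenerate fibres ⟹ `(k + 1)(l + 1)` weighted signed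
couplings `R i j = fᵢ h'ⱼ/(l+1) + hᵢ f'ⱼ/(k+1) − G hᵢ h'ⱼ/((k+1)(l+1))`, each descending once on each
side by a Newton–Leibniz move, the pieces re-summing by rule 1b one dimension up. This is the
elementary diamond across a 1b seam — the first named ingredient of `stub_diamond` of the line
`Cruxes/PeakNormalForm/Lines/birth.lean`.

The analysis is in `CommonUnfoldingPeakNormalFormWeightedCoupling.lean` (weighted descent
`of_sub_of_mem_newtonLeibnizRel_of_weightedCoupling`, weighted peak `exists_weightedCoupling`); this
file does the family bookkeeping: Newton–Leibniz data of each `B i`, `B' j` by `nl_data`, weights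
`p = 1/(l+1)`, `q = 1/(k+1)`, the swap `R' i j = (R i j).reindex (swap n (n+1))` (the second
descent is the weighted descent with the roles exchanged), and the two SEAMS
`∑ⱼ (p fᵢ + q hᵢ g'ⱼ − p q hᵢ G) = fᵢ` ⟸ `∑ⱼ g'ⱼ = G`, `(l + 1) p = 1`. No definitions are
introduced. Proof found (sorry-free, 482 lines incl. the helpers) by seat
fwd-rung-KontsevichZagierPeriods-03 (`Rung_birth.lean`, `rung_of : ∀ k l, KlInterchange k l`),
landed here under the registered stub name.

References: M. Kontsevich, D. Zagier, *Periods* (2001), §1.2, rules 1b) and 3); G. W. Anderson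
(1991) (one integral in two orders).
-/

namespace Summit.KontsevichZagierPeriods.CommonUnfolding

open Set MeasureTheory
open Literature.NumberTheory.Transcendental
open Literature.ModelTheory.ExponentialFields (IsSemialgebraic)

/-- **`k × l` interchange** (stub `stub_klInterchange` of crux `PeakNormalForm`,
stmt-KontsevichZagierPeriods-4828; the rung over `InterchangeLemma`, which is the case `k = l = 0`).
Let `k + 1` bands `B i ↘ b i` and `l + 1` bands `B' j ↘ b' j` descend by one Newton–Leibniz move each
onto the common base domain `r₂.domain`, the two families of base integrands summing to the same
`G = r₂.integrand` (a rule-1b seam: `∑ᵢ gᵢ = G = ∑ⱼ g'ⱼ`), all fibres nondegenerate. Then there are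
`(k + 1)(l + 1)` peaks `R i j` (dimension `n + 2`) with coordinate-swapped copies `R' i j` and
one-level-down pieces `c i j` on `(B i).domain`, `c' i j` on `(B' j).domain` such that
`[R i j] − [c i j]` and `[R' i j] − [c' i j]` are Newton–Leibniz moves, `∑ⱼ c i j` has the integrand
of `B i` and `∑ᵢ c' i j` that of `B' j`. Construction: with weights `p = 1/(l+1)`, `q = 1/(k+1)` and
`hᵢ = 1/(βᵢ − αᵢ)`, take the weighted signed coupling
`R i j = p·fᵢ h'ⱼ + q·hᵢ f'ⱼ − p q·G hᵢ h'ⱼ` (`exists_weightedCoupling`); each descends once on each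
side (`of_sub_of_mem_newtonLeibnizRel_of_weightedCoupling`, the second time on the swapped peak with
the roles exchanged), and the seams close because `∑ⱼ (p fᵢ + q hᵢ g'ⱼ − p q hᵢ G) = fᵢ` by
`∑ⱼ g'ⱼ = G`, `(l + 1) p = 1` (symmetrically on the other side). Proof found by seat
fwd-rung-KontsevichZagierPeriods-03. [Kontsevich–Zagier 2001, §1.2 rules 1b), 3)] [folklore] -/
theorem stub_klInterchange : ∀ (k l : ℕ) ⦃n : ℕ⦄ (r₂ : KZ.IntegralRep n)
    (B : Fin (k + 1) → KZ.IntegralRep (n + 1)) (b : Fin (k + 1) → KZ.IntegralRep n)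
    (B' : Fin (l + 1) → KZ.IntegralRep (n + 1)) (b' : Fin (l + 1) → KZ.IntegralRep n),
    (∀ i, KZ.of (B i) - KZ.of (b i) ∈ KZ.newtonLeibnizRel) →
    (∀ j, KZ.of (B' j) - KZ.of (b' j) ∈ KZ.newtonLeibnizRel) →
    (∀ i, (b i).domain = r₂.domain) → (∀ j, (b' j).domain = r₂.domain) →
    (∀ x ∈ r₂.domain, ∑ i, (b i).integrand x = r₂.integrand x) →
    (∀ x ∈ r₂.domain, ∑ j, (b' j).integrand x = r₂.integrand x) →
    (∀ i, ∀ x ∈ r₂.domain, ∃ t t' : ℝ, t < t' ∧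
      (Fin.snoc x t : Fin (n + 1) → ℝ) ∈ (B i).domain ∧
      (Fin.snoc x t' : Fin (n + 1) → ℝ) ∈ (B i).domain) →
    (∀ j, ∀ x ∈ r₂.domain, ∃ t t' : ℝ, t < t' ∧
      (Fin.snoc x t : Fin (n + 1) → ℝ) ∈ (B' j).domain ∧
      (Fin.snoc x t' : Fin (n + 1) → ℝ) ∈ (B' j).domain) →
    ∃ (R R' : Fin (k + 1) → Fin (l + 1) → KZ.IntegralRep (n + 2))
      (c c' : Fin (k + 1) → Fin (l + 1) → KZ.IntegralRep (n + 1)),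
      (∀ i j, KZ.of (R i j) - KZ.of (c i j) ∈ KZ.newtonLeibnizRel) ∧
      (∀ i j, KZ.of (R' i j) - KZ.of (c' i j) ∈ KZ.newtonLeibnizRel) ∧
      (∀ i j, (R' i j).domain =
        (fun w : Fin (n + 2) → ℝ =>
          w ∘ ⇑(Equiv.swap (Fin.castSucc (Fin.last n)) (Fin.last (n + 1)))) '' (R i j).domain) ∧
      (∀ i j, ∀ w ∈ (R i j).domain, (R i j).integrand w =
        (R' i j).integrand (w ∘ ⇑(Equiv.swap (Fin.castSucc (Fin.last n)) (Fin.last (n + 1))))) ∧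
      (∀ i j, (c i j).domain = (B i).domain) ∧ (∀ i j, (c' i j).domain = (B' j).domain) ∧
      (∀ i, ∀ z ∈ (B i).domain, ∑ j, (c i j).integrand z = (B i).integrand z) ∧
      (∀ j, ∀ z ∈ (B' j).domain, ∑ i, (c' i j).integrand z = (B' j).integrand z) := by
  intro k l n r₂ B b B' b' hB₁ hB₃ hd hd' hs hs' hne hne'
  -- Newton–Leibniz data of each band (base domain rewritten to `r₂.domain`)
  have hdat : ∀ i, ∃ (a e : (Fin n → ℝ) → ℝ) (F : (Fin (n + 1) → ℝ) → ℝ),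
      IsSemialgebraicFunOn ℚ (B i).domain F ∧ IsSemialgebraicFunOn ℚ r₂.domain a ∧
      IsSemialgebraicFunOn ℚ r₂.domain e ∧ (∀ x ∈ r₂.domain, a x ≤ e x) ∧
      (B i).domain = KZlog.band r₂.domain a e ∧
      (∀ x ∈ r₂.domain, ContinuousOn (fun t : ℝ => F (Fin.snoc x t)) (Icc (a x) (e x))) ∧
      (∀ x ∈ r₂.domain, ∀ t ∈ Ioo (a x) (e x),
        HasDerivAt (fun s : ℝ => F (Fin.snoc x s)) ((B i).integrand (Fin.snoc x t)) t) ∧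
      (∀ x ∈ r₂.domain, (b i).integrand x = F (Fin.snoc x (e x)) - F (Fin.snoc x (a x))) := by
    intro i
    obtain ⟨a, e, F, hF, ha, he, hle, hband, hcont, hderiv, hbase⟩ := nl_data (hB₁ i)
    rw [hd i] at ha he hle hband hcont hderiv hbase
    exact ⟨a, e, F, hF, ha, he, hle, hband, hcont, hderiv, hbase⟩
  have hdat' : ∀ j, ∃ (a e : (Fin n → ℝ) → ℝ) (F : (Fin (n + 1) → ℝ) → ℝ),
      IsSemialgebraicFunOn ℚ (B' j).domain F ∧ IsSemialgebraicFunOn ℚ r₂.domain a ∧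
      IsSemialgebraicFunOn ℚ r₂.domain e ∧ (∀ x ∈ r₂.domain, a x ≤ e x) ∧
      (B' j).domain = KZlog.band r₂.domain a e ∧
      (∀ x ∈ r₂.domain, ContinuousOn (fun t : ℝ => F (Fin.snoc x t)) (Icc (a x) (e x))) ∧
      (∀ x ∈ r₂.domain, ∀ t ∈ Ioo (a x) (e x),
        HasDerivAt (fun s : ℝ => F (Fin.snoc x s)) ((B' j).integrand (Fin.snoc x t)) t) ∧
      (∀ x ∈ r₂.domain, (b' j).integrand x = F (Fin.snoc x (e x)) - F (Fin.snoc x (a x))) := by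
    intro j
    obtain ⟨a, e, F, hF, ha, he, hle, hband, hcont, hderiv, hbase⟩ := nl_data (hB₃ j)
    rw [hd' j] at ha he hle hband hcont hderiv hbase
    exact ⟨a, e, F, hF, ha, he, hle, hband, hcont, hderiv, hbase⟩
  choose α β F hF hα hβ hle hband hcont hder hbase using hdat
  choose α' β' F' hF' hα' hβ' hle' hband' hcont' hder' hbase' using hdat'
  -- nondegenerate fibres
  have hlt : ∀ i, ∀ x ∈ r₂.domain, α i x < β i x := fun i x hx => by
    obtain ⟨t, t', htt', ht, ht'⟩ := hne i x hx
    rw [hband i, KZlog.snoc_mem_band] at ht ht'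
    exact (ht.2.1.trans_lt htt').trans_le ht'.2.2
  have hlt' : ∀ j, ∀ x ∈ r₂.domain, α' j x < β' j x := fun j x hx => by
    obtain ⟨t, t', htt', ht, ht'⟩ := hne' j x hx
    rw [hband' j, KZlog.snoc_mem_band] at ht ht'
    exact (ht.2.1.trans_lt htt').trans_le ht'.2.2
  have hτ := r₂.isSemialgebraic_domain
  have hG := r₂.isSemialgebraicFunOn_integrand
  have hgsa : ∀ i, IsSemialgebraicFunOn ℚ r₂.domain (b i).integrand := fun i => by
    rw [← hd i]; exact (b i).isSemialgebraicFunOn_integrand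
  have hg'sa : ∀ j, IsSemialgebraicFunOn ℚ r₂.domain (b' j).integrand := fun j => by
    rw [← hd' j]; exact (b' j).isSemialgebraicFunOn_integrand
  have hgi : ∀ i, IntegrableOn (b i).integrand r₂.domain := fun i => by
    rw [← hd i]; exact (b i).integrableOn
  have hg'i : ∀ j, IntegrableOn (b' j).integrand r₂.domain := fun j => by
    rw [← hd' j]; exact (b' j).integrableOn
  -- the weights
  set p : ℚ := ((l : ℚ) + 1)⁻¹ with hp
  set q : ℚ := ((k : ℚ) + 1)⁻¹ with hq
  -- peaks and pieces (Stub B), for every pair `(i, j)`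
  have hpk := fun i j => exists_weightedCoupling r₂.domain (α i) (β i) (α' j) (β' j) r₂.integrand (b i).integrand
    (b' j).integrand (B i) (B' j) p q hτ (hα i) (hβ i) (hα' j) (hβ' j) hG (hgsa i) (hg'sa j)
    r₂.integrableOn (hgi i) (hg'i j) (hlt i) (hlt' j) (hband i) (hband' j)
  choose R c c' hRd hRi hcd hci hc'd hc'i using hpk
  refine ⟨R, fun i j => (R i j).reindex (Equiv.swap (Fin.castSucc (Fin.last n)) (Fin.last (n + 1))),
    c, c', fun i j => ?_, fun i j => ?_, fun i j => ?_, fun i j w _ => ?_, hcd, hc'd,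
    fun i z hz => ?_, fun j z hz => ?_⟩
  · -- first descent (Stub A)
    exact of_sub_of_mem_newtonLeibnizRel_of_weightedCoupling r₂.domain (α i) (β i) (α' j) (β' j)
      r₂.integrand (b' j).integrand (F' j) (B i) (B' j) (R i j) (c i j) p q (hα i) (hβ i) (hα' j)
      (hβ' j) hG (hlt i) (hlt' j) (hband i) (hband' j) (hF' j) (hcont' j) (hder' j) (hbase' j)
      (hRd i j) (hRi i j) (hcd i j) (hci i j)
  · -- second descent (Stub A with the roles exchanged, on the swapped peak)
    have hR'd : ((R i j).reindex (Equiv.swap (Fin.castSucc (Fin.last n)) (Fin.last (n + 1)))).domain =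
        KZlog.band (KZlog.band r₂.domain (α' j) (β' j)) (fun z => α i (Fin.init z))
          (fun z => β i (Fin.init z)) := by
      rw [KZ.IntegralRep.reindex_domain, hRd]
      exact setOf_comp_swap_mem_dband _ _ _ _ _
    refine of_sub_of_mem_newtonLeibnizRel_of_weightedCoupling r₂.domain (α' j) (β' j) (α i) (β i)
      r₂.integrand (b i).integrand (F i) (B' j) (B i) _ (c' i j) q p (hα' j) (hβ' j) (hα i) (hβ i)
      hG (hlt' j) (hlt i) (hband' j) (hband i) (hF i) (hcont i) (hder i) (hbase i) hR'd
      (fun w hw => ?_) (hc'd i j) (hc'i i j)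
    have hw' : (fun idx => w (Equiv.swap (Fin.castSucc (Fin.last n)) (Fin.last (n + 1)) idx)) ∈
        (R i j).domain := hw
    have hsw : (Fin.snoc (Fin.init (Fin.init w)) (w (Fin.castSucc (Fin.last n))) :
        Fin (n + 1) → ℝ) = Fin.init w := Fin.snoc_init_self _
    rw [KZ.IntegralRep.reindex_integrand]
    show (R i j).integrand _ = _
    rw [hRi i j _ hw']
    simp only [KZ.init_comp_swap, KZ.comp_swap_last, Fin.init_snoc, hsw]
    ring
  · -- the domain of `R'` is the swap image of the domain of `R`
    ext w
    simp only [KZ.IntegralRep.reindex_domain, mem_setOf_eq, mem_image]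
    constructor
    · intro hw
      exact ⟨_, hw, funext fun i => by simp⟩
    · rintro ⟨v, hv, rfl⟩
      simpa using hv
  · -- the integrands agree along the swap
    simp [KZ.IntegralRep.reindex_integrand]
  · -- seam on `B i`: `∑ⱼ (p fᵢ + q hᵢ g'ⱼ − p q hᵢ G) = fᵢ`
    have hx : Fin.init z ∈ r₂.domain := by
      rw [hband i] at hz
      exact hz.1
    have h1 : β i (Fin.init z) - α i (Fin.init z) ≠ 0 := (sub_pos.2 (hlt i _ hx)).ne'
    rw [Finset.sum_congr rfl fun j _ => hci i j z hz, Finset.sum_sub_distrib,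
      Finset.sum_add_distrib, Finset.sum_const, Finset.sum_const, Finset.card_univ,
      Fintype.card_fin, ← Finset.mul_sum, ← Finset.sum_mul, hs' _ hx]
    simp only [nsmul_eq_mul, hp, hq]
    push_cast
    field_simp
    ring
  · -- seam on `B' j`: `∑ᵢ (q f'ⱼ + p h'ⱼ gᵢ − q p h'ⱼ G) = f'ⱼ`
    have hx : Fin.init z ∈ r₂.domain := by
      rw [hband' j] at hz
      exact hz.1
    have h3 : β' j (Fin.init z) - α' j (Fin.init z) ≠ 0 := (sub_pos.2 (hlt' j _ hx)).ne'
    rw [Finset.sum_congr rfl fun i _ => hc'i i j z hz, Finset.sum_sub_distrib,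
      Finset.sum_add_distrib, Finset.sum_const, Finset.sum_const, Finset.card_univ,
      Fintype.card_fin, ← Finset.mul_sum, ← Finset.sum_mul, hs _ hx]
    simp only [nsmul_eq_mul, hp, hq]
    push_cast
    field_simp
    ring

end Summit.KontsevichZagierPeriods.CommonUnfolding
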